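/-
HONEST FRAMING: certified error envelopes and provably optimal rounding/accumulation schemes for
low-precision formats under stated cost models; every table by two implementations; no hardware
or vendor claims.
-/
import Summits.Ventures.CertifiedArithmetic.LowPrec.OptDemotionAllLines

/-!
# The demotion law (Theorem T8), part 6g: the line-level covering lemmas of the MONO/W reduction

HOME `CONJECTURE-D-NODESTEP.md` §G10 (lean seat gen 10) reduces the all-tree node step of the
full-family cap invariant at a node `a·b` (root scale 1, excess `x`) to the single-tree properties
MONO and W of the children (part 6f, `OptDemotionMonoW`).  The reduction itself is elementary: every
configuration is bounded by a reading of ONE line of `a` and ONE line of `b`, and each such reading is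
dominated by one of the four transforms `F1 … F4` of part 6a.  THIS FILE proves those line-level
covering inequalities (no floats, no envelopes — pure algebra over `ℚ` plus membership in `L_{a·b}`),
so that the future node lemma `node_covers_of_monoW` is float bookkeeping only:

* `spine_cover_lines` — SPINE configurations (child `a` in the root binade with excess `x - z`, child
  `b` squeezed, its deficit read — via MONO(b) — on a line `(α_b, λ_b)` at pseudo-scale `z` with excess
  `u`): `u + (α_a + λ_a (x-z)) + (α_b z + λ_b u) ≤ G_{a·b}(x)` for ALL `0 ≤ z ≤ x` (affine in `z`;
  endpoints = `F1(ℓ_a)` and `F3(ℓ_b)`); `spine_cover_zero` — the case `z = 0` (`b` gets exactly `u`);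
* `exchange_cover` — BOTH-BELOW configurations with `x_a + x_b = 1 + ξ ≥ 1`: the max-slope exchange
  `(ℓ_a(x_a) + ℓ_b(x_b))/2 ≤ max(μ_a + ℓ_b(ξ)/2, μ_b + ℓ_a(ξ)/2)` (else `μ_a < μ_b` and `μ_b < μ_a`);
* `affine_endpoints` — BOTH-BELOW with `x_a + x_b < 1`: the two-line reading is bounded by the
  endpoint configurations `(x_a + x_b, 0)`, `(0, x_a + x_b)`;
* `window_cover_of_W` — the endpoint configuration "`a` at the top of the lower binade, `b` EXACTLY at
  the power of two": from the W-inequality `(1-u)V ≤ Gy + (1-2u)B` (numbers: `V = G_a(2y+2u)`,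
  `Gy = G_a(y)`, `B = B_a(y)`), for EVERY sibling weight `m ≥ 0`:
  `(V + m)/2 ≤ max(Gy + u m, m + B)` — the window of part 6f is empty.
-/

namespace Summit.Ventures.CertifiedArithmetic.LowPrec.Opt

open Literature.ComputerArithmetic.JeannerodRump2018
open Literature.ComputerArithmetic.JeannerodRump2018.SumTree

/-! ## Spine configurations -/

/-- **SPINE COVER.**  `a` keeps the root binade with excess `x - z`, its deficit read on its line
`la ∈ L_a`; `b` receives `z + u`, its deficit read on a line `lb ∈ L_b` at pseudo-scale `z` with
excess `u` (this is what MONO(b) provides).  Then the root loss `u` plus both readings is below the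
parent envelope `G_{a·b}(x) = treeQf u (a·b) x - 1 - x`, for every `0 ≤ z ≤ x`. -/
theorem spine_cover_lines {u : ℚ} (hu : 0 < u) (hu1 : u ≤ 1) (a b : SumTree) {x z : ℚ}
    (hz : 0 ≤ z) (hzx : z ≤ x) {la lb : ℚ × ℚ} (hla : la ∈ allLines u a)
    (hlb : lb ∈ allLines u b) :
    u + (la.1 + la.2 * (x - z)) + (lb.1 * z + lb.2 * u) ≤ treeQf u (.node a b) x - 1 - x := by
  have hx : 0 ≤ x := le_trans hz hzx
  obtain ⟨hla2, hla2M, hla1, hla1M⟩ := allLines_bounds hu.le hu1 a la hla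
  obtain ⟨hlb2, hlb2M, hlb1, hlb1M⟩ := allLines_bounds hu.le hu1 b lb hlb
  -- the two endpoint lines of the parent family
  have hF1 := allLine_le_treeQf_of_nonneg hu hu1 (.node a b) (mem_allLines_F1 (b := b) hla) hx
  have hF3 := allLine_le_treeQf_of_nonneg hu hu1 (.node a b) (mem_allLines_F3 (a := a) hlb) hx
  dsimp only at hF1 hF3
  -- affine in z: compare the slope lb.1 - la.2 with 0
  rcases le_total lb.1 la.2 with h | h
  · -- value ≤ value at z = 0 ≤ F1(la)
    nlinarith [mul_le_mul_of_nonneg_left hlb2M hu.le, mul_nonneg hz (sub_nonneg.2 h)]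
  · -- value ≤ value at z = x ≤ F3(lb)
    nlinarith [mul_nonneg (sub_nonneg.2 hzx) (sub_nonneg.2 h)]

/-- **SPINE COVER, `z = 0`**: `a` takes the whole excess, `b` gets exactly `u` (deficit `≤ u·μ_b`). -/
theorem spine_cover_zero {u : ℚ} (hu : 0 < u) (hu1 : u ≤ 1) (a b : SumTree) {x : ℚ} (hx : 0 ≤ x)
    {la : ℚ × ℚ} (hla : la ∈ allLines u a) {B : ℚ} (hB : B ≤ u * (treeM u b - 1)) :
    u + (la.1 + la.2 * x) + B ≤ treeQf u (.node a b) x - 1 - x := by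
  have hF1 := allLine_le_treeQf_of_nonneg hu hu1 (.node a b) (mem_allLines_F1 (b := b) hla) hx
  dsimp only at hF1
  linarith

/-! ## Both-below configurations -/

/-- **THE MAX-SLOPE EXCHANGE** (both children in the lower binade, `x_a + x_b = 1 + ξ ≥ 1`): the
two-line reading is dominated by pushing one child to exactly the root scale (deficit `μ`) and the
other down to excess `ξ` on the SAME line; otherwise `μ_a < μ_b` and `μ_b < μ_a`. -/
theorem exchange_cover {u : ℚ} (hu0 : 0 ≤ u) (hu1 : u ≤ 1) (a b : SumTree) {xa xb ξ : ℚ}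
    (hxa : xa ≤ 1) (hxb : xb ≤ 1) (hξ : 0 ≤ ξ) (hsum : xa + xb = 1 + ξ)
    {la lb : ℚ × ℚ} (hla : la ∈ allLines u a) (hlb : lb ∈ allLines u b) :
    (la.1 + la.2 * xa + (lb.1 + lb.2 * xb)) / 2 ≤
      max ((treeM u a - 1) + (lb.1 + lb.2 * ξ) / 2) ((treeM u b - 1) + (la.1 + la.2 * ξ) / 2) := by
  obtain ⟨hla2, hla2M, hla1, hla1M⟩ := allLines_bounds hu0 hu1 a la hla
  obtain ⟨hlb2, hlb2M, hlb1, hlb1M⟩ := allLines_bounds hu0 hu1 b lb hlb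
  have hξa : ξ ≤ xa := by linarith
  have hξb : ξ ≤ xb := by linarith
  rcases le_total (treeM u b - 1) (treeM u a - 1) with h | h
  · -- μ_b ≤ μ_a: push `a` up
    refine le_trans ?_ (le_max_left _ _)
    -- la.1 ≤ μ_a, la.2 ≤ μ_a, lb.2 ≤ μ_b ≤ μ_a, and xa + (xb - ξ) = 1
    nlinarith [mul_le_mul_of_nonneg_right hla2M (le_trans hξ hξa),
      mul_le_mul_of_nonneg_right (le_trans hlb2M h) (sub_nonneg.2 hξb)]
  · refine le_trans ?_ (le_max_right _ _)
    nlinarith [mul_le_mul_of_nonneg_right hlb2M (le_trans hξ hξb),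
      mul_le_mul_of_nonneg_right (le_trans hla2M h) (sub_nonneg.2 hξa)]

/-- **AFFINE ENDPOINTS** (both children in the lower binade, `x_a + x_b < 1`): the two-line reading is
bounded by one of the endpoint configurations `(x_a + x_b, 0)`, `(0, x_a + x_b)`. -/
theorem affine_endpoints {xa xb : ℚ} (hxa : 0 ≤ xa) (hxb : 0 ≤ xb) (la lb : ℚ × ℚ) :
    la.1 + la.2 * xa + (lb.1 + lb.2 * xb) ≤
      max (la.1 + la.2 * (xa + xb) + lb.1) (la.1 + (lb.1 + lb.2 * (xa + xb))) := by
  rcases le_total lb.2 la.2 with h | h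
  · refine le_trans ?_ (le_max_left _ _); nlinarith [mul_nonneg hxb (sub_nonneg.2 h)]
  · refine le_trans ?_ (le_max_right _ _); nlinarith [mul_nonneg hxa (sub_nonneg.2 h)]

/-- **THE WINDOW IS EMPTY UNDER W.**  Numbers: `V = G_a(2y+2u)` (child `a` at the top of the lower
binade), `Gy = G_a(y)` (the straight cover `S_a`), `B = B_a(y)` (the squeezed reading of `a` when the
sibling is doubled to the root scale), `m = μ_b` the sibling's weight (any rational), `u ≤ 1/2`.  If the
W-inequality `(1-u)·V ≤ Gy + (1-2u)·B` holds then the endpoint configuration `(V + m)/2` is covered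
by `S_a = Gy + u·m` or by `m + B`, WHATEVER `m` is. -/
theorem window_cover_of_W {u V Gy B : ℚ} (m : ℚ) (hu2 : u ≤ 1 / 2)
    (hW : (1 - u) * V ≤ Gy + (1 - 2 * u) * B) :
    (V + m) / 2 ≤ max (Gy + u * m) (m + B) := by
  by_contra h
  push Not at h
  have h1 : Gy + u * m < (V + m) / 2 := lt_of_le_of_lt (le_max_left _ _) h
  have h2 : m + B < (V + m) / 2 := lt_of_le_of_lt (le_max_right _ _) h
  have h12 : 0 ≤ 1 - 2 * u := by linarith
  nlinarith [mul_le_mul_of_nonneg_left h2.le h12]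

end Summit.Ventures.CertifiedArithmetic.LowPrec.Opt
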